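import Summits.Ventures.Crystal3D.Theorems.StickyWulffConstantTextureLiminfTexShadowLayerRowsDefs
import Summits.Ventures.Crystal3D.Theorems.StickyWulffConstantTextureLiminfTexShadowFluxPairSteerTiltCover
import HarnessLib

/-!
# «LAYER ROWS» cut, Cover-dependent half: the flux-pair sliver is inside the row-certified regime, up to the rows' read class
# (lane T, crux `TextureLiminfV5`, stmt-Ventures-23912, registered stub `stub_edgeOnFlux`; cf-p1 RULINGS (ccix)/(ccx)(A); 19480-p1 g16)

HONEST FRAMING. Venture `Summits/Ventures/Crystal3D` (cell `crystal3d-full`), route `route-Ventures-StickyWulffConstant`, helper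
`--supports` the law-v5 crux `TextureLiminfV5` (stmt-Ventures-23912).  Logic only; the in-layer row machine R1 (19480-p2) enters as the hypothesis
`LayerRowsMachine Apart C_R1` ('…LayerRowsDefs'); no certificate; rung F-C1 not moved.

* `RowReadAt Apart c₀` — the rows' READ class: edge-on flux-failing pairs whose plate-1 row frames are NOT apart from plate 2 (`¬ Apart`; measure zero for
  R1's apartness predicate; NOT the Cover's `ReadAt`, which presupposes the flux clause);
* **`edgeOnFlux_of_layerRowsMachine`** — `LayerRowsMachine Apart C_R1 → BilayerWallFaultedOnAt (EdgeOnAt (13/25) ∧ FluxPairFailAt (13/25) ∧ Apart)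
  (13/25) ((C_R1 + 80·19 + 3456 + 1152·11)/2) 10` (by `inner_axis_sq_lt_of_fluxPairFailAt`: the sliver has `⟪L₁ e₃, e₃⟫² < 1/20`, then
  `faultedOnAt_of_layerRowsMachine`); `residualFaultedCoreOnAt_edgeOnFlux_of_layerRowsMachine` — the `∃ C` core-on-regime form;
* `edgeOnFlux_split` — `EdgeOnAt ∧ FluxPairFailAt` is the union of the row-certified regime and `RowReadAt`.
WHAT THIS IS NOT: not R1, not a payer for `RowReadAt`; F-C1 not moved.
-/

noncomputable section

open scoped BigOperators InnerProductSpace ENNReal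
open MeasureTheory

namespace Summit.Ventures.Crystal3D.Cruxes.TextureLiminf.TexShadow

open Summit.Ventures.Crystal3D Summit.Ventures.Crystal3D.Theorems
open Literature.MathematicalPhysics.StatisticalMechanics (IsHaggSeq)

/-- **The rows' READ class at charge `c₀`**: edge-on, flux-pair-failing pairs whose plate-1 rows are NOT apart from plate 2 (`¬ Apart`). -/
def RowReadAt (Apart : (ℤ → ℤ) → (ℤ → ℤ) → (E3 ≃ₗᵢ[ℝ] E3) → (E3 ≃ₗᵢ[ℝ] E3) → Prop) (c₀ : ℝ) (σ₁ σ₂ : ℤ → ℤ) (L₁ L₂ : E3 ≃ₗᵢ[ℝ] E3) : Prop :=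
  EdgeOnAt c₀ σ₁ σ₂ L₁ L₂ ∧ FluxPairFailAt c₀ σ₁ σ₂ L₁ L₂ ∧ ¬ Apart σ₁ σ₂ L₁ L₂

/-- The split of the flux-pair class by apartness (pure logic). -/
theorem edgeOnFlux_split (Apart : (ℤ → ℤ) → (ℤ → ℤ) → (E3 ≃ₗᵢ[ℝ] E3) → (E3 ≃ₗᵢ[ℝ] E3) → Prop) (c₀ : ℝ) (σ₁ σ₂ : ℤ → ℤ)
    (L₁ L₂ : E3 ≃ₗᵢ[ℝ] E3) (h : EdgeOnAt c₀ σ₁ σ₂ L₁ L₂ ∧ FluxPairFailAt c₀ σ₁ σ₂ L₁ L₂) :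
    (EdgeOnAt c₀ σ₁ σ₂ L₁ L₂ ∧ FluxPairFailAt c₀ σ₁ σ₂ L₁ L₂ ∧ Apart σ₁ σ₂ L₁ L₂) ∨ RowReadAt Apart c₀ σ₁ σ₂ L₁ L₂ := by
  by_cases ha : Apart σ₁ σ₂ L₁ L₂
  · exact Or.inl ⟨h.1, h.2, ha⟩
  · exact Or.inr ⟨h.1, h.2, ha⟩

/-- **THE FLUX-SLIVER CUT BY LAYER ROWS**: the in-layer row machine pays the whole cell law at cap `13/25` on
`EdgeOnAt (13/25) ∧ FluxPairFailAt (13/25) ∧ Apart` — the sliver has plate 1 within `arcsin √(1/20)` of edge-on (`inner_axis_sq_lt_of_fluxPairFailAt`). -/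
theorem edgeOnFlux_of_layerRowsMachine {Apart : (ℤ → ℤ) → (ℤ → ℤ) → (E3 ≃ₗᵢ[ℝ] E3) → (E3 ≃ₗᵢ[ℝ] E3) → Prop} {C_R1 : ℝ}
    (hR1 : LayerRowsMachine Apart C_R1) :
    BilayerWallFaultedOnAt (fun σ₁ σ₂ L₁ L₂ => EdgeOnAt (13 / 25) σ₁ σ₂ L₁ L₂ ∧ FluxPairFailAt (13 / 25) σ₁ σ₂ L₁ L₂ ∧ Apart σ₁ σ₂ L₁ L₂)
      (13 / 25) ((C_R1 + 80 * (10 + 9) + 3456 + 1152 * (10 + 1)) / 2) 10 :=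
  bilayerWallFaultedOnAt_mono (fun _ _ _ _ ⟨_, hflux, hapart⟩ => ⟨(inner_axis_sq_lt_of_fluxPairFailAt hflux).1, hapart⟩)
    (faultedOnAt_of_layerRowsMachine hR1)

/-- **The `∃ C` core-on-regime form** (the shape in which `stub_edgeOnFlux` is cut): from the machine statement. -/
theorem residualFaultedCoreOnAt_edgeOnFlux_of_layerRowsMachine {Apart : (ℤ → ℤ) → (ℤ → ℤ) → (E3 ≃ₗᵢ[ℝ] E3) → (E3 ≃ₗᵢ[ℝ] E3) → Prop}
    {C_R1 : ℝ} (hR1 : LayerRowsMachine Apart C_R1) :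
    ∃ C : ℝ, BilayerWallResidualFaultedCoreOnAt
      (fun σ₁ σ₂ L₁ L₂ => EdgeOnAt (13 / 25) σ₁ σ₂ L₁ L₂ ∧ FluxPairFailAt (13 / 25) σ₁ σ₂ L₁ L₂ ∧ Apart σ₁ σ₂ L₁ L₂) (13 / 25) C 10 :=
  ⟨_, residualFaultedCoreOnAt_of_faultedOnAt (edgeOnFlux_of_layerRowsMachine hR1)⟩

/-- The plate-2 twin: rows of plate 2 pay on `EdgeOnAt ∧ FluxPairFailAt ∧ Apart` as well (the sliver also has `⟪L₂ e₃, e₃⟫² < 1/20`). -/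
theorem edgeOnFlux_of_layerRowsMachineTop {Apart : (ℤ → ℤ) → (ℤ → ℤ) → (E3 ≃ₗᵢ[ℝ] E3) → (E3 ≃ₗᵢ[ℝ] E3) → Prop} {C_R1 : ℝ}
    (hR1 : LayerRowsMachineTop Apart C_R1) :
    BilayerWallFaultedOnAt (fun σ₁ σ₂ L₁ L₂ => EdgeOnAt (13 / 25) σ₁ σ₂ L₁ L₂ ∧ FluxPairFailAt (13 / 25) σ₁ σ₂ L₁ L₂ ∧ Apart σ₁ σ₂ L₁ L₂)
      (13 / 25) ((C_R1 + 80 * (10 + 9) + 3456 + 1152 * (10 + 1)) / 2) 10 :=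
  bilayerWallFaultedOnAt_mono (fun _ _ _ _ ⟨_, hflux, hapart⟩ => ⟨(inner_axis_sq_lt_of_fluxPairFailAt hflux).2, hapart⟩)
    (faultedOnAt_of_layerRowsMachineTop hR1)

/-! ## The bump glue: flux sliver = (rows' core on `Apart`) ∪ (read class), as ONE named step

With `residualFaultedCoreOnAt_union` / `residualFaultedCoreOnAt_anti` ('…TexShadowSemanticCutGlue') the registered `stub_edgeOnFlux` is DERIVED from
the two classes exactly as `stub_edgeOnRep` was from three (`edgeOnRep_of_threeClasses`). -/

/-- **Flux sliver from its two classes** (any charge `c₀`, any `R₀ ≥ 0`): a core on `EdgeOnAt ∧ FluxPairFailAt ∧ Apart` and a core on the read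
class `RowReadAt Apart c₀` give the core on the whole flux-pair class `EdgeOnAt ∧ FluxPairFailAt`, at `max` of the constants. -/
theorem edgeOnFlux_of_twoClasses {Apart : (ℤ → ℤ) → (ℤ → ℤ) → (E3 ≃ₗᵢ[ℝ] E3) → (E3 ≃ₗᵢ[ℝ] E3) → Prop} {c₀ R₀ : ℝ} (hR₀ : 0 ≤ R₀)
    (hrows : ∃ C : ℝ, BilayerWallResidualFaultedCoreOnAt
      (fun σ₁ σ₂ L₁ L₂ => EdgeOnAt c₀ σ₁ σ₂ L₁ L₂ ∧ FluxPairFailAt c₀ σ₁ σ₂ L₁ L₂ ∧ Apart σ₁ σ₂ L₁ L₂) c₀ C R₀)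
    (hread : ∃ C : ℝ, BilayerWallResidualFaultedCoreOnAt (RowReadAt Apart c₀) c₀ C R₀) :
    ∃ C : ℝ, BilayerWallResidualFaultedCoreOnAt
      (fun σ₁ σ₂ L₁ L₂ => EdgeOnAt c₀ σ₁ σ₂ L₁ L₂ ∧ FluxPairFailAt c₀ σ₁ σ₂ L₁ L₂) c₀ C R₀ := by
  obtain ⟨C₁, h₁⟩ := hrows
  obtain ⟨C₂, h₂⟩ := hread
  exact ⟨max C₁ C₂, residualFaultedCoreOnAt_anti (fun σ₁ σ₂ L₁ L₂ h => edgeOnFlux_split Apart c₀ σ₁ σ₂ L₁ L₂ h)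
    (residualFaultedCoreOnAt_union hR₀ h₁ h₂)⟩

/-- **`stub_edgeOnFlux` DERIVED** (bump C′ shape, cap `13/25`, `R₀ = 10`): the in-layer row machine on `Apart` plus a core on the rows' read class give
the registered flux-sliver statement `∃ C, BilayerWallResidualFaultedCoreOnAt (EdgeOnAt (13/25) ∧ FluxPairFailAt (13/25)) (13/25) C 10`. -/
theorem edgeOnFlux_of_layerRowsMachine_of_rowRead {Apart : (ℤ → ℤ) → (ℤ → ℤ) → (E3 ≃ₗᵢ[ℝ] E3) → (E3 ≃ₗᵢ[ℝ] E3) → Prop} {C_R1 : ℝ}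
    (hR1 : LayerRowsMachine Apart C_R1)
    (hread : ∃ C : ℝ, BilayerWallResidualFaultedCoreOnAt (RowReadAt Apart (13 / 25)) (13 / 25) C 10) :
    ∃ C : ℝ, BilayerWallResidualFaultedCoreOnAt
      (fun σ₁ σ₂ L₁ L₂ => EdgeOnAt (13 / 25) σ₁ σ₂ L₁ L₂ ∧ FluxPairFailAt (13 / 25) σ₁ σ₂ L₁ L₂) (13 / 25) C 10 :=
  edgeOnFlux_of_twoClasses (by norm_num) (residualFaultedCoreOnAt_edgeOnFlux_of_layerRowsMachine hR1) hread

end Summit.Ventures.Crystal3D.Cruxes.TextureLiminf.TexShadow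

end
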